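import Mathlib
import Summits.NavierStokesRegularity.NavierStokesRegularity.Theorems.EulerZoomLiouvillePowerGaugeEulerLiouvilleCondenserMember
import Summits.NavierStokesRegularity.NavierStokesRegularity.Theorems.EulerZoomLiouvillePowerGaugeEulerLiouvilleCondenserGaugeForm
import Summits.NavierStokesRegularity.NavierStokesRegularity.Theorems.EulerZoomLiouvillePowerGaugeEulerLiouvilleSelfSimilarVorticalEscape
import Summits.NavierStokesRegularity.NavierStokesRegularity.Theorems.EulerZoomLiouvillePowerGaugeEulerLiouvilleSelfSimilarIrrotationalGrowth
import Summits.NavierStokesRegularity.NavierStokesRegularity.Theorems.EulerZoomLiouvillePowerGaugeEulerLiouvilleSelfSimilarSublinearConfinement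

/-!
# MINIMAL EXPONENTIAL TYPE AT THE CRITICAL ORDER KILLS (LEAD 19832's KEY «C-MIN», 17:58:14Z; nsreg-p2 g33's liminf form, 17:59:19Z)

Width piece for crux `EulerZoomLiouville.PowerGaugeEulerLiouville` (stmt-NavierStokesRegularity-19832), by name under
LEAD 19832 (ns-typeII-p2 g12); seat ns-ezl-w2 g3, `--supports stmt-NavierStokesRegularity-19832 --as helper`.

**`selfSimilar_ae_eq_zero_of_minimalTypeGradientC2`** — an exactly self-similar `C²` member of the crux class (crux binders VERBATIM,
`γ = 1/(2+ρ)`, `0 < ρ ≤ ½`) whose profile gradient has MINIMAL LOWER EXPONENTIAL TYPE at the critical order `2+ρ`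
(`∀ c' > 0, ∀ R₀, ∃ R ≥ R₀, sup_{B(0,3R)} ‖DV‖ ≤ exp(c' R^{2+ρ})`, i.e. `liminf_R R^{−(2+ρ)} log sup_{B(0,3R)}‖DV‖ ≤ 0`) is TRIVIAL.

Route (all by name): ROUND-42 THEOREM B in gauge form (ns-in-ser-c g3's t44-B `Condenser.exists_gradient_ge_exp_rpow_of_exit`, on
`…CondenserCrossings`) with the class budgets of the profile (`NeedleThinCore.selfSimilar_needle_inputs`,
`NeedleRace.lintegral_fderiv_sq_closedBall_le`, as in `…CondenserMember`): at every radius `R` handed out by the hypothesis with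
`c'` half the condenser exponent, NO backward orbit of a `C²` cut-off copy (`Loc.exists_cutoff_local`, `= V` on `ball 0 (3R)`) leaves
`B(0,2R)` from `B(0,R)`; there the cut-off orbit is a true backward similarity trajectory of `V`, so every vortical point of `B(0,R)`
is CONFINED, a null event (`Loc.volume_vortical_confined_eq_zero`); `{curl V ≠ 0} ∩ B(0,R)` is open and null, hence empty; the radii
are unbounded, so `curl V ≡ 0` and `Loc.selfSimilar_ae_eq_zero_of_irrotationalC2_profile` ends it.

CONSEQUENCE FOR THE ONE STATEMENT (LEAD wires by name): the `C²` needle has POSITIVE LOWER TYPE at order `2+ρ` —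
`∃ c' > 0, ∃ R₀, ∀ R ≥ R₀, sup_{B(0,3R)}‖DV‖ > exp(c' R^{2+ρ})` — enemy (α) of ROUND-42/43 is compulsory at EVERY large scale.

HONEST FRAMING: a stratum of the crux CLASS (hypothetical blow-up members); nothing here proves the crux E `PowerGaugeEulerLiouville`
(19832 OPEN), any door Target, or Navier–Stokes regularity; MODEL lattice only (19832 = E/NS strata, not NS regularity).
[cite: ConstantinIgnatovaVicol2026Putative, §3.4.1; folklore (length–area method)]
-/

noncomputable section

open Set Filter Topology Metric Function MeasureTheory Real
open scoped RealInnerProductSpace NNReal ENNReal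

set_option linter.dupNamespace false

namespace Summit.NavierStokesRegularity.NavierStokesRegularity.Theorems.PowerGaugeEulerLiouville.Condenser

open Literature.Analysis Literature.Analysis.FluidPDE
open Summit.NavierStokesRegularity.NavierStokesRegularity.Theorems.PowerGaugeEulerLiouville

/-- **MINIMAL EXPONENTIAL TYPE AT THE CRITICAL ORDER KILLS** (KEY «C-MIN»).  See the module docstring.
[cite: ConstantinIgnatovaVicol2026Putative, §3.4.1; folklore (length–area method)] -/
theorem selfSimilar_ae_eq_zero_of_minimalTypeGradientC2 {ρ : ℝ} (hρ : 0 < ρ) (hρ1 : ρ ≤ 1 / 2)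
    {u : ℝ → EuclideanSpace ℝ (Fin 3) → EuclideanSpace ℝ (Fin 3)} {p : ℝ → EuclideanSpace ℝ (Fin 3) → ℝ}
    {H : ℝ → EuclideanSpace ℝ (Fin 3) → EuclideanSpace ℝ (Fin 3) →L[ℝ] EuclideanSpace ℝ (Fin 3)} {c : ℝ≥0}
    (hsw : IsSuitableWeakSolutionOn (slab (EuclideanSpace ℝ (Fin 3)) (Iio 0) isOpen_Iio) 0 0 u p)
    (hH : HasWeakSpatialGradientOn (slab (EuclideanSpace ℝ (Fin 3)) (Iio 0) isOpen_Iio) u H)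
    (hgauge : ∀ a : ℝ, 0 < a →
      ENNReal.ofReal (a ^ (2 * ρ)) * cknA a (0 : ℝ × EuclideanSpace ℝ (Fin 3)) u +
          ENNReal.ofReal (a ^ ρ) * cknE a (0 : ℝ × EuclideanSpace ℝ (Fin 3)) H +
        ENNReal.ofReal (a ^ (2 * ρ)) * cknD a (0 : ℝ × EuclideanSpace ℝ (Fin 3)) p ≤ (c : ℝ≥0∞))
    {V : EuclideanSpace ℝ (Fin 3) → EuclideanSpace ℝ (Fin 3)} {P : EuclideanSpace ℝ (Fin 3) → ℝ}
    (hu : ∀ τ : ℝ, τ < 0 → u τ = selfSimilarCollapse (1 / (2 + ρ)) 0 V τ)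
    (hp : ∀ τ : ℝ, τ < 0 → p τ = selfSimilarCollapsePressure (1 / (2 + ρ)) 0 P τ)
    (hV : ContDiff ℝ 2 V)
    (hgrad : ∀ c' : ℝ, 0 < c' → ∀ R₀ : ℝ, ∃ R : ℝ, R₀ ≤ R ∧
      ∀ z ∈ ball (0 : EuclideanSpace ℝ (Fin 3)) (3 * R), ‖fderiv ℝ V z‖ ≤ Real.exp (c' * R ^ (2 + ρ))) :
    uncurry u =ᵐ[volume.restrict (Iio (0 : ℝ) ×ˢ (univ : Set (EuclideanSpace ℝ (Fin 3))))] 0 := by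
  have hρ1' : ρ < 1 := by linarith
  have h2ρ : (0 : ℝ) < 2 + ρ := by linarith
  have hγ : (0 : ℝ) < 1 / (2 + ρ) := one_div_pos.2 h2ρ
  have hγ2 : 1 / (2 + ρ) < 1 / 2 := one_div_lt_one_div_of_lt two_pos (by linarith)
  have hV1 : ContDiff ℝ 1 V := hV.of_le (by norm_num)
  -- ### a classical pressure for the profile
  have hA : ∀ a : ℝ, 0 < a → ENNReal.ofReal (a ^ (2 * ρ)) *
      cknA a (0 : ℝ × EuclideanSpace ℝ (Fin 3)) u ≤ (c : ℝ≥0∞) :=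
    fun a ha => le_trans (le_trans le_self_add le_self_add) (hgauge a ha)
  have hD : ∀ a : ℝ, 0 < a → ENNReal.ofReal (a ^ (2 * ρ)) *
      cknD a (0 : ℝ × EuclideanSpace ℝ (Fin 3)) p ≤ (c : ℝ≥0∞) :=
    fun a ha => le_trans le_add_self (hgauge a ha)
  have hpm : AEStronglyMeasurable (uncurry p)
      (volume.restrict (Iio (0 : ℝ) ×ˢ (univ : Set (EuclideanSpace ℝ (Fin 3))))) := by
    have := hsw.distributional.2.2.1.aestronglyMeasurable
    simpa [slab] using this
  have hPm := aestronglyMeasurable_pressureProfile hpm hp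
  have hDprof := profile_pressure_weight_of_gaugeD hρ hρ1' hpm hp hD
  have hP1 : LocallyIntegrable P volume :=
    EnergySaturation.locallyIntegrable_pressure_of_weight hρ1' hPm
      (ENNReal.mul_ne_top ENNReal.ofReal_ne_top ENNReal.coe_ne_top) hDprof
  obtain ⟨P', hprof⟩ :=
    WeakToClassical.exists_isSelfSimilarEulerProfile_of_contDiff hsw.distributional hu hp hV hP1
  -- ### the class budgets of the profile on balls `B(0,3R)`
  obtain ⟨hA', hE'⟩ :=
    NeedleThinCore.selfSimilar_needle_inputs hρ hρ1' hsw hH hgauge hu hp hV1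
  set CA : ℝ := (c : ℝ) + 1 with hCA
  set CE : ℝ := (1 - ρ) / (2 + ρ) * (c : ℝ) + 1 with hCE
  have hE0 : 0 ≤ (1 - ρ) / (2 + ρ) * (c : ℝ) := by
    have : 0 ≤ 1 - ρ := by linarith
    positivity
  have hCApos : 0 < CA := by positivity
  have hCEpos : 0 < CE := by positivity
  have hbA : ∀ R : ℝ, 0 < R →
      ∫ x in ball (0 : EuclideanSpace ℝ (Fin 3)) (3 * R), ‖V x‖ ^ 2 ≤ CA * (3 * R) ^ (1 - 2 * ρ) := by
    intro R hR
    have h3R0 : (0 : ℝ) < 3 * R := by linarith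
    have hX : 0 ≤ CA * (3 * R) ^ (1 - 2 * ρ) := by positivity
    refine setIntegral_sq_le_of_lintegral hV.continuous hX ((hA' (3 * R) h3R0).trans ?_)
    rw [hCA, ← ENNReal.ofReal_coe_nnreal, ← ENNReal.ofReal_mul (NNReal.coe_nonneg c)]
    exact ENNReal.ofReal_le_ofReal (by nlinarith [Real.rpow_nonneg h3R0.le (1 - 2 * ρ), NNReal.coe_nonneg c])
  have hbE : ∀ R : ℝ, 1 ≤ R →
      ∫ x in ball (0 : EuclideanSpace ℝ (Fin 3)) (3 * R), ‖fderiv ℝ V x‖ ^ 2 ≤ CE * (3 * R) ^ (1 - ρ) := by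
    intro R hR
    have h3R1 : (1 : ℝ) ≤ 3 * R := by linarith
    have h3R0 : (0 : ℝ) < 3 * R := by linarith
    have h1 := NeedleRace.lintegral_fderiv_sq_closedBall_le hρ1' hE0 hE' h3R1
    have h2 : ∫⁻ z in ball (0 : EuclideanSpace ℝ (Fin 3)) (3 * R), ‖fderiv ℝ V z‖ₑ ^ 2 ≤
        ENNReal.ofReal ((1 - ρ) / (2 + ρ) * (c : ℝ) * (3 * R) ^ (1 - ρ)) :=
      (lintegral_mono_set ball_subset_closedBall).trans h1
    have hY : 0 ≤ CE * (3 * R) ^ (1 - ρ) := by positivity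
    refine setIntegral_sq_le_of_lintegral (hV.continuous_fderiv (by norm_num)) hY (h2.trans ?_)
    exact ENNReal.ofReal_le_ofReal (by rw [hCE]; nlinarith [Real.rpow_nonneg h3R0.le (1 - ρ)])
  -- ### THEOREM B in gauge form (t44-B), and the exponent split
  obtain ⟨R₁, hR₁, hB⟩ := exists_gradient_ge_exp_rpow_of_exit (γ := 1 / (2 + ρ)) (ρ := ρ) hγ hρ.le hCApos hCEpos
  set κ : ℝ := Real.pi * (1 / (2 + ρ)) ^ 2 / (128 * (3 : ℝ) ^ (1 - ρ) * CE) with hκ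
  have hκpos : 0 < κ := by
    have : 0 < (3 : ℝ) ^ (1 - ρ) := Real.rpow_pos_of_pos (by norm_num) _
    rw [hκ]; positivity
  set c' : ℝ := κ / 2 with hc'
  have hc'pos : 0 < c' := by positivity
  set Rlog : ℝ := 2 * (Real.log (2 / (1 / (2 + ρ))) + 1) / κ with hRlog
  -- ### the profile is irrotational
  have hcurl : ∀ x : EuclideanSpace ℝ (Fin 3), curl V x = 0 := by
    intro x
    by_contra hx
    -- a radius handed out by the hypothesis
    obtain ⟨R, hR, hgradR⟩ := hgrad c' hc'pos (max (max R₁ 1) (max (‖x‖ + 1) Rlog))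
    have hRR₁ : R₁ ≤ R := ((le_max_left _ _).trans (le_max_left _ _)).trans hR
    have hR1 : 1 ≤ R := ((le_max_right _ _).trans (le_max_left _ _)).trans hR
    have hRx : ‖x‖ + 1 ≤ R := ((le_max_left _ _).trans (le_max_right _ _)).trans hR
    have hRlogR : Rlog ≤ R := ((le_max_right _ _).trans (le_max_right _ _)).trans hR
    have hR0 : 0 < R := by linarith
    -- a `C²` cut-off copy agreeing with `V` on `ball 0 (3R)`
    obtain ⟨Vc, hVc2, -, -, ⟨K, hK⟩, hVU⟩ := Loc.exists_cutoff_local hV (R := 3 * R) (by positivity)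
    have hVc1 : ContDiff ℝ 1 Vc := hVc2.of_le (by norm_num)
    have hfd : ∀ z ∈ ball (0 : EuclideanSpace ℝ (Fin 3)) (3 * R), fderiv ℝ Vc z = fderiv ℝ V z := fun z hz =>
      Filter.EventuallyEq.fderiv_eq (Filter.eventually_of_mem (isOpen_ball.mem_nhds hz) hVU)
    have hAc : ∫ z in ball (0 : EuclideanSpace ℝ (Fin 3)) (3 * R), ‖Vc z‖ ^ 2 ≤ CA * (3 * R) ^ (1 - 2 * ρ) := by
      rw [setIntegral_congr_fun measurableSet_ball (fun z hz => by rw [hVU z hz])]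
      exact hbA R hR0
    have hEc : ∫ z in ball (0 : EuclideanSpace ℝ (Fin 3)) (3 * R), ‖fderiv ℝ Vc z‖ ^ 2 ≤ CE * (3 * R) ^ (1 - ρ) := by
      rw [setIntegral_congr_fun measurableSet_ball (fun z hz => by rw [hfd z hz])]
      exact hbE R hR1
    -- NO EXIT at this scale
    have hnoexit : ∀ y : EuclideanSpace ℝ (Fin 3), ‖y‖ < R → ∀ L : ℝ, 0 ≤ L →
        ‖ODE.evolutionMap (fun _ : ℝ => selfSimilarTransport (1 / (2 + ρ)) 0 Vc) 0 (-L) y‖ < 2 * R := by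
      intro y hy L hL
      by_contra hex
      push Not at hex
      obtain ⟨z, hz, hzle⟩ := hB Vc K hVc1 hK R hRR₁ hAc hEc y L hL hy hex
      rw [hfd z hz] at hzle
      have h1 := hzle.trans (hgradR z hz)
      -- `γ/2 · e^{κ R^{2+ρ}} ≤ e^{(κ/2) R^{2+ρ}}` is impossible for `R ≥ Rlog`
      have hRpow : R ≤ R ^ (2 + ρ) := by
        have : R ^ (1 : ℝ) ≤ R ^ (2 + ρ) := Real.rpow_le_rpow_of_exponent_le hR1 (by linarith)
        rwa [Real.rpow_one] at this
      have h2 : Real.log (2 / (1 / (2 + ρ))) + 1 ≤ c' * R ^ (2 + ρ) := by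
        have h3 : Real.log (2 / (1 / (2 + ρ))) + 1 = c' * Rlog := by
          rw [hc', hRlog]; field_simp
        rw [h3]
        exact mul_le_mul_of_nonneg_left (hRlogR.trans hRpow) hc'pos.le
      have hκc : κ = c' + c' := by rw [hc']; ring
      have h4 : 1 / (2 + ρ) / 2 * Real.exp (κ * R ^ (2 + ρ)) =
          (1 / (2 + ρ) / 2 * Real.exp (c' * R ^ (2 + ρ))) * Real.exp (c' * R ^ (2 + ρ)) := by
        rw [hκc, add_mul, Real.exp_add]; ring
      rw [h4] at h1
      have h5 : 1 / (2 + ρ) / 2 * Real.exp (c' * R ^ (2 + ρ)) ≤ 1 :=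
        le_of_mul_le_mul_right (by simpa using h1) (Real.exp_pos _)
      -- but `e^{c' R^{2+ρ}} ≥ e · (2/γ)`
      have h6 : Real.exp (Real.log (2 / (1 / (2 + ρ))) + 1) ≤ Real.exp (c' * R ^ (2 + ρ)) := Real.exp_le_exp.2 h2
      rw [Real.exp_add, Real.exp_log (by positivity)] at h6
      have h7 : (1 : ℝ) < Real.exp 1 := by
        have := Real.add_one_lt_exp (by norm_num : (1 : ℝ) ≠ 0)
        linarith
      have hγ' : 0 < 1 / (2 + ρ) / 2 := by positivity
      have h8 : 1 / (2 + ρ) / 2 * (2 / (1 / (2 + ρ)) * Real.exp 1) ≤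
          1 / (2 + ρ) / 2 * Real.exp (c' * R ^ (2 + ρ)) := mul_le_mul_of_nonneg_left h6 hγ'.le
      have h9 : 1 / (2 + ρ) / 2 * (2 / (1 / (2 + ρ)) * Real.exp 1) = Real.exp 1 := by
        field_simp
      linarith
    -- CONFINEMENT: every vortical point of `B(0,R)` has a backward `V`-trajectory staying in `B̄(0,2R)`
    have hnull := Loc.volume_vortical_confined_eq_zero hprof hγ hγ2 (N := 2 * R) (by positivity)
    set O : Set (EuclideanSpace ℝ (Fin 3)) := ball 0 R ∩ {x' | curl V x' ≠ 0} with hO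
    have hOopen : IsOpen O :=
      isOpen_ball.inter (isOpen_ne_fun (differentiable_curl_of_contDiff hV).continuous continuous_const)
    have hxO : x ∈ O := ⟨mem_ball_zero_iff.2 (by linarith), hx⟩
    have hOsub : O ⊆ {x' : EuclideanSpace ℝ (Fin 3) | curl V x' ≠ 0 ∧
        ∃ Y : ℝ → EuclideanSpace ℝ (Fin 3), Y 0 = x' ∧
          (∀ t, 0 ≤ t → HasDerivAt Y ((-1 : ℝ) • selfSimilarTransport (1 / (2 + ρ)) 0 V (Y t)) t) ∧
          ∀ t, 0 ≤ t → ‖Y t‖ ≤ 2 * R} := by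
      rintro x' ⟨hx'R, hx'c⟩
      refine ⟨hx'c, fun t => ODE.evolutionMap (fun _ : ℝ => selfSimilarTransport (1 / (2 + ρ)) 0 Vc) 0 (-t) x',
        ?_, ?_, ?_⟩
      · simp [ODE.evolutionMap_self]
      · intro t ht
        have h := C2.Kelvin.hasDerivAt_flow_neg (γ := 1 / (2 + ρ)) hVc1 hK x' t
        have hin : ODE.evolutionMap (fun _ : ℝ => selfSimilarTransport (1 / (2 + ρ)) 0 Vc) 0 (-t) x' ∈
            ball (0 : EuclideanSpace ℝ (Fin 3)) (3 * R) :=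
          mem_ball_zero_iff.2 ((hnoexit x' (mem_ball_zero_iff.1 hx'R) t ht).trans (by linarith))
        have hW : selfSimilarTransport (1 / (2 + ρ)) 0 Vc
              (ODE.evolutionMap (fun _ : ℝ => selfSimilarTransport (1 / (2 + ρ)) 0 Vc) 0 (-t) x') =
            selfSimilarTransport (1 / (2 + ρ)) 0 V
              (ODE.evolutionMap (fun _ : ℝ => selfSimilarTransport (1 / (2 + ρ)) 0 Vc) 0 (-t) x') := by
          rw [selfSimilarTransport_apply, selfSimilarTransport_apply, hVU _ hin]
        rw [hW] at h
        exact h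
      · intro t ht
        exact (hnoexit x' (mem_ball_zero_iff.1 hx'R) t ht).le
    have hO0 : volume O = 0 := measure_mono_null hOsub hnull
    exact (hOopen.measure_pos volume ⟨x, hxO⟩).ne' hO0
  -- ### conclusion
  exact Loc.selfSimilar_ae_eq_zero_of_irrotationalC2_profile hρ hsw.distributional hA hu hV hcurl

end Summit.NavierStokesRegularity.NavierStokesRegularity.Theorems.PowerGaugeEulerLiouville.Condenser

end
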